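import Literature.Probability.RandomPlanarGeometry.LSW2004KeyEstimateComputation
import Literature.Probability.LatticeModels.SphereReflectionPositivityNecessity
import HarnessLib

/-!
# [LSW04 §3.2 ⇝ SAW] The change-of-target observable: the `κ = 8/3` key-estimate computation

G. F. Lawler, O. Schramm, W. Werner, *Conformal invariance of planar loop-erased random walks and
uniform spanning trees*, Ann. Probab. **32** (2004) 939–995 (**[LSW04]**), §3.2 / Prop. 3.4 (UST
twin: Prop. 4.3, formalised in `LSW2004KeyEstimateComputation`): the *key estimate*
`E[W | atom] = O(δ³)`, `E[W² - κt | atom] = O(δ³)` along mesoscopic Loewner steps comes from a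
**martingale observable** `q` (conditional mean `1`) within `O(δ³)` of an explicit functional
`F(U, D, W)` of the one-step Loewner data: Taylor-expand `F` (second order in the driving
increment `W`, first order in the capacity `t`) at **two** observation points and solve the
`2 × 2` linear system; the ratio of the `W²`- and `t`-coefficients is `κ`.

This file is that deterministic step ("observable ⇒ key estimate") **transposed to the planar
self-avoiding walk** and the *change-of-target observable* (idea `target-change-rn`): the
Radon–Nikodym ratio of the SAW law aimed at an auxiliary boundary target `z` versus the law aimed
at the true target, whose `SLE₈/₃` value after one mesoscopic Loewner step is
`rnF x U D W = (x² D / (U - W)²)^{5/8}` (`x` = current position of the auxiliary target,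
`U = g(x)`, `D = g′(x)`, `W` = driving increment; `5/8 = (6 - κ)/(2κ)` at `κ = 8/3` is the
restriction exponent of `SLE₈/₃`, Lawler–Schramm–Werner 2003). With the Loewner far field
`U = x + 2t/x + O(δ³)`, `D = 1 - 2t/x² + O(δ³)` (`|W| ≤ 2δ`, `0 ≤ t ≤ 2δ²`):
`rnF = (1 + y)^{5/8}`, `y := x² D/(U - W)² - 1 = 2W/x + (3W² - 6t)/x² + O(δ³)`,
`(1 + y)^{5/8} = 1 + (5/8) y - (15/128) y² + O(y³)`, whence
**`rnF = 1 + (5/4) W/x + ((45/32) W² - (15/4) t)/x² + O(δ³)`** (`rnF_taylor`); two targets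
`x₁ ∈ [1, 2]`, `x₂ ∈ [-2, -1]` give `E[W] = O(δ³)`, `(45/32) E[W²] - (15/4) E[t] = O(δ³)`, i.e.
**`E[W²] - (8/3) E[t] = O(δ³)`** as `(15/4)/(45/32) = 8/3` (`rn_key_relations`,
`rnKey_of_estimates`, on any probability space — to be applied atom by atom with `P` = the
conditional law). The SAW input producing the hypotheses (the discrete observable, its martingale
property, its `O(δ³)`-closeness to `rnF`) is not here.

References: [LSW04] §3.2, Prop. 3.4; §4.2, Prop. 4.3 (proof) [LawlerSchrammWerner2004];
G. F. Lawler, O. Schramm, W. Werner, *Conformal restriction: the chordal case*, J. Amer. Math.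
Soc. **16** (2003) 917–955, Theorem 8.4 [LawlerSchrammWerner2003Restriction].
-/

noncomputable section

open MeasureTheory

namespace Literature.Probability.RandomPlanarGeometry.SAWDriving

/-- **The change-of-target functional.** The `SLE₈/₃` value, after one Loewner step with data
`U = g(x)`, `D = g′(x)`, driving increment `W`, of the Radon–Nikodym ratio of the law aimed at the
boundary point `x` versus the law aimed at `∞`: `(x² D/(U - W)²)^{5/8}`, `5/8` the restriction
exponent of `SLE₈/₃`. [cite: LawlerSchrammWerner2003Restriction, Theorem 8.4] -/
def rnF (x U D W : ℝ) : ℝ := (x ^ 2 * D / (U - W) ^ 2) ^ (5 / 8 : ℝ)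

/-- **`(1 + y)^{5/8} = 1 + (5/8) y - (15/128) y² + O(|y|³)`**, quantitatively near `y = 0`
(from the binomial series). [folklore] -/
theorem rn_exists_rpow_taylor : ∃ r : ℝ, 0 < r ∧ ∃ C : ℝ, 0 ≤ C ∧ ∀ y : ℝ, |y| < r →
    |(1 + y) ^ (5 / 8 : ℝ) - 1 - 5 / 8 * y + 15 / 128 * y ^ 2| ≤ C * |y| ^ 3 := by
  obtain ⟨C, hC0, hC⟩ :=
    (Literature.Probability.LatticeModels.isBigO_one_add_rpow_sub_taylor_two
      (5 / 8 : ℝ)).exists_nonneg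
  obtain ⟨r, hr, h⟩ := Metric.eventually_nhds_iff.1 hC.bound
  refine ⟨r, hr, C, hC0, fun y hy ↦ ?_⟩
  have h1 := h (show dist y 0 < r by rwa [Real.dist_eq, sub_zero])
  rw [Real.norm_eq_abs, Real.norm_eq_abs, abs_pow, abs_abs] at h1
  rw [show (1 + y) ^ (5 / 8 : ℝ) - 1 - 5 / 8 * y + 15 / 128 * y ^ 2 =
      (1 + y) ^ (5 / 8 : ℝ) - (1 + 5 / 8 * y + 5 / 8 * (5 / 8 - 1) / 2 * y ^ 2) by ring]
  exact h1

/-! ### The algebra of `y = x² D/(U - W)² - 1` -/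

/-- The numerator of `y - (2W/x + (3W² - 6t)/x²)`, `y = x² D/(U - W)² - 1`, regrouped into
manifestly `O(δ³)` pieces: with `a := U - W - x`, `e₁ := U - x - 2t/x`, `e₂ := D - (1 - 2t/x²)`,
`x² D - (U - W)² - (2W/x + (3W² - 6t)/x²)(U - W)²
  = x² e₂ - 2x e₁ - (a + W)(a + 3W) - 2W a²/x - (3W² - 6t)(2a/x + a²/x²)`.
[cite: LawlerSchrammWerner2004, §3.2] -/
theorem rnF_numerator_identity {x : ℝ} (U D W t : ℝ) (hx : x ≠ 0) :
    x ^ 2 * D - (U - W) ^ 2 - (2 * W / x + (3 * W ^ 2 - 6 * t) / x ^ 2) * (U - W) ^ 2 =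
      x ^ 2 * (D - (1 - 2 * t / x ^ 2)) - 2 * x * (U - x - 2 * t / x)
        - (U - W - x + W) * (U - W - x + 3 * W) - 2 * W * (U - W - x) ^ 2 / x
        - (3 * W ^ 2 - 6 * t) * (2 * (U - W - x) / x + (U - W - x) ^ 2 / x ^ 2) := by
  field_simp
  ring

/-- The `O(δ³)` bound on that numerator (and `|U - W - x| ≤ (6 + K)δ`), for `0 < δ ≤ 1`,
`1 ≤ |x| ≤ 2`, `|W| ≤ 2δ`, `0 ≤ t ≤ 2δ²`, `|U - x - 2t/x| ≤ Kδ³`, `|D - (1 - 2t/x²)| ≤ Kδ³`.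
[cite: LawlerSchrammWerner2004, §3.2] -/
theorem rnF_abs_numerator_le {K δ x U D W t : ℝ} (hK : 0 ≤ K) (hδ : 0 < δ) (hδ1 : δ ≤ 1)
    (hx1 : 1 ≤ |x|) (hx2 : |x| ≤ 2) (hW : |W| ≤ 2 * δ) (ht0 : 0 ≤ t) (ht : t ≤ 2 * δ ^ 2)
    (hU : |U - x - 2 * t / x| ≤ K * δ ^ 3) (hD : |D - (1 - 2 * t / x ^ 2)| ≤ K * δ ^ 3) :
    |U - W - x| ≤ (6 + K) * δ ∧
    |x ^ 2 * D - (U - W) ^ 2 - (2 * W / x + (3 * W ^ 2 - 6 * t) / x ^ 2) * (U - W) ^ 2| ≤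
      (8 * K + (4 + K) * (12 + K) + 4 * (6 + K) ^ 2 + 24 * (2 * (6 + K) + (6 + K) ^ 2)) *
        δ ^ 3 := by
  have hx0 : x ≠ 0 := fun h ↦ by rw [h, abs_zero] at hx1; exact absurd hx1 (by norm_num)
  have pm : ∀ {p q A B : ℝ}, |p| ≤ A → |q| ≤ B → |p * q| ≤ A * B := fun hp hq ↦ by
    rw [abs_mul]; exact mul_le_mul hp hq (abs_nonneg _) ((abs_nonneg _).trans hp)
  have hδ2 : δ ^ 2 ≤ δ := pow_le_of_le_one hδ.le hδ1 two_ne_zero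
  have hδ32 : δ ^ 3 ≤ δ ^ 2 := pow_le_pow_of_le_one hδ.le hδ1 (by norm_num)
  have hKδ : K * δ ^ 3 ≤ K * δ ^ 2 := mul_le_mul_of_nonneg_left hδ32 hK
  have hKδ' : (4 + K) * δ ^ 2 ≤ (4 + K) * δ := mul_le_mul_of_nonneg_left hδ2 (by positivity)
  have hdiv : ∀ p : ℝ, |p / x| ≤ |p| := fun p ↦ by
    rw [abs_div]; exact div_le_self (abs_nonneg _) hx1
  have hdiv2 : ∀ p : ℝ, |p / x ^ 2| ≤ |p| := fun p ↦ by
    rw [abs_div, abs_pow]; exact div_le_self (abs_nonneg _) (one_le_pow₀ hx1)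
  have h2tx : |2 * t / x| ≤ 4 * δ ^ 2 :=
    (hdiv _).trans (by rw [abs_of_nonneg (by positivity : (0 : ℝ) ≤ 2 * t)]; linarith)
  obtain ⟨a, ha_def⟩ : ∃ a : ℝ, a = U - W - x := ⟨_, rfl⟩
  have haW : |a + W| ≤ (4 + K) * δ ^ 2 := by
    rw [show a + W = (U - x - 2 * t / x) + 2 * t / x by rw [ha_def]; ring]
    linarith [abs_add_le (U - x - 2 * t / x) (2 * t / x)]
  have ha : |a| ≤ (6 + K) * δ := by
    have h := abs_sub (a + W) W
    rw [add_sub_cancel_right] at h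
    linarith
  have ha3W : |a + 3 * W| ≤ (12 + K) * δ := by
    have h := abs_add_le (a + W) (2 * W)
    rw [abs_mul, abs_two, show a + W + 2 * W = a + 3 * W by ring] at h
    linarith
  have hW2 : W ^ 2 ≤ (2 * δ) ^ 2 := by
    rw [← sq_abs W]; exact pow_le_pow_left₀ (abs_nonneg W) hW 2
  have hWt : |3 * W ^ 2 - 6 * t| ≤ 24 * δ ^ 2 := by
    rw [abs_le]; constructor <;> linarith [sq_nonneg W, sq_nonneg δ]
  have ha2 : |a ^ 2| ≤ ((6 + K) * δ) ^ 2 := by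
    rw [abs_pow]; exact pow_le_pow_left₀ (abs_nonneg a) ha 2
  refine ⟨by rw [← ha_def]; exact ha, ?_⟩
  rw [rnF_numerator_identity U D W t hx0, ← ha_def]
  have hx4 : |x ^ 2| ≤ 4 := by
    rw [abs_pow]; exact (pow_le_pow_left₀ (abs_nonneg x) hx2 2).trans_eq (by norm_num)
  have hx4' : |2 * x| ≤ 4 := by rw [abs_mul, abs_two]; linarith
  have h2W : |2 * W| ≤ 4 * δ := by rw [abs_mul, abs_two]; linarith
  have h2a : |2 * a| ≤ 2 * ((6 + K) * δ) := by rw [abs_mul, abs_two]; linarith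
  have hT1 := pm hx4 hD
  have hT2 := pm hx4' hU
  have hT3 := pm haW ha3W
  have hT4 : |2 * W * a ^ 2 / x| ≤ 4 * δ * ((6 + K) * δ) ^ 2 :=
    (hdiv _).trans (pm h2W ha2)
  have hin : |2 * a / x + a ^ 2 / x ^ 2| ≤ (2 * (6 + K) + (6 + K) ^ 2) * δ := by
    have hsq : (6 + K) ^ 2 * δ ^ 2 ≤ (6 + K) ^ 2 * δ :=
      mul_le_mul_of_nonneg_left hδ2 (sq_nonneg _)
    linarith [abs_add_le (2 * a / x) (a ^ 2 / x ^ 2), hdiv (2 * a), hdiv2 (a ^ 2)]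
  have hT5 := pm hWt hin
  have i1 := abs_sub (x ^ 2 * (D - (1 - 2 * t / x ^ 2)) - 2 * x * (U - x - 2 * t / x)
    - (a + W) * (a + 3 * W) - 2 * W * a ^ 2 / x)
    ((3 * W ^ 2 - 6 * t) * (2 * a / x + a ^ 2 / x ^ 2))
  have i2 := abs_sub (x ^ 2 * (D - (1 - 2 * t / x ^ 2)) - 2 * x * (U - x - 2 * t / x)
    - (a + W) * (a + 3 * W)) (2 * W * a ^ 2 / x)
  have i3 := abs_sub (x ^ 2 * (D - (1 - 2 * t / x ^ 2)) - 2 * x * (U - x - 2 * t / x))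
    ((a + W) * (a + 3 * W))
  have i4 := abs_sub (x ^ 2 * (D - (1 - 2 * t / x ^ 2))) (2 * x * (U - x - 2 * t / x))
  linarith

/-! ### The pointwise expansion of `rnF` -/

/-- **Taylor expansion of the change-of-target functional** ([LSW04] §3.2 recipe, SAW version):
for every `K ≥ 0` there are `δ₀ > 0` and `C` such that for `0 < δ ≤ δ₀`, whenever `1 ≤ |x| ≤ 2`,
`|W| ≤ 2δ`, `0 ≤ t ≤ 2δ²`, `|U - x - 2t/x| ≤ Kδ³` and `|D - (1 - 2t/x²)| ≤ Kδ³`,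
`|rnF x U D W - 1 - ((5/4) W/x + ((45/32) W² - (15/4) t)/x²)| ≤ C δ³` (via `rnF = (1 + y)^{5/8}`,
`y = 2W/x + (3W² - 6t)/x² + O(δ³)`, `y² = 4W²/x² + O(δ³)`). [cite: LawlerSchrammWerner2004, §3.2] -/
theorem rnF_taylor (K : ℝ) (hK : 0 ≤ K) : ∃ δ₀ : ℝ, 0 < δ₀ ∧ ∃ C : ℝ, ∀ δ : ℝ, 0 < δ → δ ≤ δ₀ →
    ∀ x U D W t : ℝ, 1 ≤ |x| → |x| ≤ 2 → |W| ≤ 2 * δ → 0 ≤ t → t ≤ 2 * δ ^ 2 →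
      |U - x - 2 * t / x| ≤ K * δ ^ 3 → |D - (1 - 2 * t / x ^ 2)| ≤ K * δ ^ 3 →
      |rnF x U D W - 1 - (5 / 4 * W / x + (45 / 32 * W ^ 2 - 15 / 4 * t) / x ^ 2)| ≤ C * δ ^ 3 := by
  obtain ⟨r, hr, CT, hCT, hT⟩ := rn_exists_rpow_taylor
  obtain ⟨CN, hCN⟩ : ∃ CN : ℝ,
      CN = 8 * K + (4 + K) * (12 + K) + 4 * (6 + K) ^ 2 + 24 * (2 * (6 + K) + (6 + K) ^ 2) :=
    ⟨_, rfl⟩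
  have hCN0 : 0 ≤ CN := by rw [hCN]; positivity
  refine ⟨min 1 (min (1 / (2 * (6 + K))) (r / (2 * (28 + 4 * CN)))),
    lt_min one_pos (lt_min (by positivity) (by positivity)),
    CT * (28 + 4 * CN) ^ 3 + 5 / 2 * CN + 15 / 128 * ((4 * CN + 24) * (32 + 4 * CN)), ?_⟩
  intro δ hδ hδ₀ x U D W t hx1 hx2 hW ht0 ht hU hD
  have hδ1 : δ ≤ 1 := hδ₀.trans (min_le_left _ _)
  have hδA : δ ≤ 1 / (2 * (6 + K)) := hδ₀.trans ((min_le_right _ _).trans (min_le_left _ _))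
  have hδr : δ ≤ r / (2 * (28 + 4 * CN)) :=
    hδ₀.trans ((min_le_right _ _).trans (min_le_right _ _))
  have hδ2 : δ ^ 2 ≤ δ := pow_le_of_le_one hδ.le hδ1 two_ne_zero
  have hδ32 : δ ^ 3 ≤ δ ^ 2 := pow_le_pow_of_le_one hδ.le hδ1 (by norm_num)
  have hCδ : CN * δ ^ 3 ≤ CN * δ ^ 2 := mul_le_mul_of_nonneg_left hδ32 hCN0
  have hCδ' : CN * δ ^ 2 ≤ CN * δ := mul_le_mul_of_nonneg_left hδ2 hCN0
  have hdiv : ∀ p : ℝ, |p / x| ≤ |p| := fun p ↦ by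
    rw [abs_div]; exact div_le_self (abs_nonneg _) hx1
  have hdiv2 : ∀ p : ℝ, |p / x ^ 2| ≤ |p| := fun p ↦ by
    rw [abs_div, abs_pow]; exact div_le_self (abs_nonneg _) (one_le_pow₀ hx1)
  obtain ⟨ha, hN⟩ := rnF_abs_numerator_le hK hδ hδ1 hx1 hx2 hW ht0 ht hU hD
  rw [← hCN] at hN
  -- `(U - W)² ≥ 1/4`
  have haA : |U - W - x| ≤ 1 / 2 := by
    calc |U - W - x| ≤ (6 + K) * δ := ha
      _ ≤ (6 + K) * (1 / (2 * (6 + K))) := mul_le_mul_of_nonneg_left hδA (by positivity)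
      _ = 1 / 2 := by field_simp
  have hu : 1 / 2 ≤ |U - W| := by
    have h1 := abs_sub (U - W) (U - W - x)
    rw [show U - W - (U - W - x) = x by ring] at h1
    linarith
  have hu2 : 1 / 4 ≤ (U - W) ^ 2 := by
    have h := pow_le_pow_left₀ (by norm_num : (0 : ℝ) ≤ 1 / 2) hu 2
    rw [sq_abs] at h
    linarith [h]
  have hupos : 0 < (U - W) ^ 2 := by linarith
  -- `y` and its linear part `L`
  obtain ⟨L, hL_def⟩ : ∃ L : ℝ, L = 2 * W / x + (3 * W ^ 2 - 6 * t) / x ^ 2 := ⟨_, rfl⟩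
  rw [← hL_def] at hN
  obtain ⟨y, hy_def⟩ : ∃ y : ℝ, y = x ^ 2 * D / (U - W) ^ 2 - 1 := ⟨_, rfl⟩
  have hyL : |y - L| ≤ 4 * CN * δ ^ 3 := by
    have e : y - L = (x ^ 2 * D - (U - W) ^ 2 - L * (U - W) ^ 2) / (U - W) ^ 2 := by
      rw [hy_def, eq_div_iff hupos.ne']
      linear_combination div_mul_cancel₀ (x ^ 2 * D) hupos.ne'
    rw [e, abs_div, abs_of_pos hupos, div_le_iff₀ hupos]
    linarith [mul_le_mul_of_nonneg_left hu2 (by positivity : (0 : ℝ) ≤ 4 * CN * δ ^ 3)]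
  have hW2 : W ^ 2 ≤ (2 * δ) ^ 2 := by
    rw [← sq_abs W]; exact pow_le_pow_left₀ (abs_nonneg W) hW 2
  have h2Wx : |2 * W / x| ≤ 4 * δ := (hdiv _).trans (by rw [abs_mul, abs_two]; linarith)
  have h3x : |(3 * W ^ 2 - 6 * t) / x ^ 2| ≤ 24 * δ ^ 2 :=
    (hdiv2 _).trans (by rw [abs_le]; constructor <;> linarith [sq_nonneg W, sq_nonneg δ])
  have hLb : |L| ≤ 28 * δ := by
    rw [hL_def]
    linarith [abs_add_le (2 * W / x) ((3 * W ^ 2 - 6 * t) / x ^ 2)]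
  have hyb : |y| ≤ (28 + 4 * CN) * δ := by
    have h := abs_add_le (y - L) L
    rw [sub_add_cancel] at h
    linarith
  have hyr : |y| < r := by
    calc |y| ≤ (28 + 4 * CN) * δ := hyb
      _ ≤ (28 + 4 * CN) * (r / (2 * (28 + 4 * CN))) :=
          mul_le_mul_of_nonneg_left hδr (by positivity)
      _ = r / 2 := by field_simp
      _ < r := by linarith
  have hy3 : |y| ^ 3 ≤ ((28 + 4 * CN) * δ) ^ 3 := pow_le_pow_left₀ (abs_nonneg y) hyb 3
  have hTb := (hT y hyr).trans (mul_le_mul_of_nonneg_left hy3 hCT)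
  -- `y² = 4W²/x² + O(δ³)`
  have h1 : |y - 2 * W / x| ≤ (4 * CN + 24) * δ ^ 2 := by
    have h := abs_add_le (y - L) ((3 * W ^ 2 - 6 * t) / x ^ 2)
    rw [show y - L + (3 * W ^ 2 - 6 * t) / x ^ 2 = y - 2 * W / x by rw [hL_def]; ring] at h
    linarith
  have h2 : |y + 2 * W / x| ≤ (28 + 4 * CN) * δ + 4 * δ := by
    linarith [abs_add_le y (2 * W / x)]
  have hsq : |y ^ 2 - 4 * W ^ 2 / x ^ 2| ≤ (4 * CN + 24) * δ ^ 2 * ((28 + 4 * CN) * δ + 4 * δ) := by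
    rw [show y ^ 2 - 4 * W ^ 2 / x ^ 2 = (y - 2 * W / x) * (y + 2 * W / x) by ring, abs_mul]
    exact mul_le_mul h1 h2 (abs_nonneg _) ((abs_nonneg _).trans h1)
  have key : rnF x U D W - 1 - (5 / 4 * W / x + (45 / 32 * W ^ 2 - 15 / 4 * t) / x ^ 2) =
      ((1 + y) ^ (5 / 8 : ℝ) - 1 - 5 / 8 * y + 15 / 128 * y ^ 2) + 5 / 8 * (y - L)
        - 15 / 128 * (y ^ 2 - 4 * W ^ 2 / x ^ 2) := by
    rw [rnF, hL_def, show x ^ 2 * D / (U - W) ^ 2 = 1 + y by rw [hy_def]; ring]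
    ring
  rw [key]
  have i1 := abs_sub ((1 + y) ^ (5 / 8 : ℝ) - 1 - 5 / 8 * y + 15 / 128 * y ^ 2 + 5 / 8 * (y - L))
    (15 / 128 * (y ^ 2 - 4 * W ^ 2 / x ^ 2))
  have i2 := abs_add_le ((1 + y) ^ (5 / 8 : ℝ) - 1 - 5 / 8 * y + 15 / 128 * y ^ 2)
    (5 / 8 * (y - L))
  rw [abs_mul (15 / 128 : ℝ), abs_of_pos (by norm_num : (0 : ℝ) < 15 / 128)] at i1
  rw [abs_mul (5 / 8 : ℝ), abs_of_pos (by norm_num : (0 : ℝ) < 5 / 8)] at i2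
  linarith

/-! ### The `2 × 2` system at two observation points -/

/-- **"Combining these two relations"** for the change-of-target observable: if
`|(5/4) B/x₁ + M/x₁²| ≤ ε` and `|(5/4) B/x₂ + M/x₂²| ≤ ε` with `x₁ ∈ [1, 2]`, `x₂ ∈ [-2, -1]`
(`B = E[W]`, `M = (45/32) E[W²] - (15/4) E[t]`), then `|B| ≤ 4ε` and `|M| ≤ 16ε` (the system has
`x₁ - x₂ ≥ 2`). [folklore] -/
theorem rn_key_relations {x₁ x₂ B M ε : ℝ} (hx₁ : 1 ≤ x₁) (hx₁' : x₁ ≤ 2) (hx₂ : -2 ≤ x₂)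
    (hx₂' : x₂ ≤ -1) (h₁ : |5 / 4 * B / x₁ + M / x₁ ^ 2| ≤ ε)
    (h₂ : |5 / 4 * B / x₂ + M / x₂ ^ 2| ≤ ε) :
    |B| ≤ 4 * ε ∧ |M| ≤ 16 * ε := by
  have hx₁p : 0 < x₁ := by linarith
  have hx₂n : x₂ < 0 := by linarith
  have hε : 0 ≤ ε := (abs_nonneg _).trans h₁
  have e₁ : 5 / 4 * B * x₁ + M = x₁ ^ 2 * (5 / 4 * B / x₁ + M / x₁ ^ 2) := by
    linear_combination (-(5 / 4 * x₁)) * div_mul_cancel₀ B hx₁p.ne' -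
      div_mul_cancel₀ M (pow_ne_zero 2 hx₁p.ne')
  have e₂ : 5 / 4 * B * x₂ + M = x₂ ^ 2 * (5 / 4 * B / x₂ + M / x₂ ^ 2) := by
    linear_combination (-(5 / 4 * x₂)) * div_mul_cancel₀ B hx₂n.ne -
      div_mul_cancel₀ M (pow_ne_zero 2 hx₂n.ne)
  have g₁ : |5 / 4 * B * x₁ + M| ≤ 4 * ε := by
    rw [e₁, abs_mul, abs_of_nonneg (sq_nonneg x₁)]
    exact mul_le_mul (by nlinarith) h₁ (abs_nonneg _) (by norm_num)
  have g₂ : |5 / 4 * B * x₂ + M| ≤ 4 * ε := by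
    rw [e₂, abs_mul, abs_of_nonneg (sq_nonneg x₂)]
    exact mul_le_mul (by nlinarith) h₂ (abs_nonneg _) (by norm_num)
  have k : |5 / 4 * B * (x₁ - x₂)| ≤ 8 * ε := by
    rw [show 5 / 4 * B * (x₁ - x₂) = (5 / 4 * B * x₁ + M) - (5 / 4 * B * x₂ + M) by ring]
    exact (abs_sub _ _).trans (by linarith)
  have hB : |B| ≤ 4 * ε := by
    rw [abs_mul, abs_mul, abs_of_pos (by norm_num : (0 : ℝ) < 5 / 4),
      abs_of_pos (by linarith : (0 : ℝ) < x₁ - x₂)] at k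
    linarith [abs_nonneg B, mul_le_mul_of_nonneg_left (by linarith : 2 ≤ x₁ - x₂) (abs_nonneg B)]
  refine ⟨hB, ?_⟩
  have hM := abs_sub (5 / 4 * B * x₁ + M) (5 / 4 * B * x₁)
  rw [add_sub_cancel_left, abs_mul (5 / 4 * B), abs_mul,
    abs_of_pos (by norm_num : (0 : ℝ) < 5 / 4), abs_of_pos hx₁p] at hM
  linarith [mul_le_mul hB hx₁' hx₁p.le (by linarith [abs_nonneg B] : (0 : ℝ) ≤ 4 * ε)]

/-! ### Integration on a probability space -/

/-- One observation point, integrated: if `q` has mean `1` and is within `Kδ³` of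
`rnF x U D W`, which is within `Cδ³` of `1 + (5/4) W/x + ((45/32) W² - (15/4) t)/x²`, then
`|(5/4) E[W]/x + ((45/32) E[W²] - (15/4) E[t])/x²| ≤ (C + K) δ³`.
[cite: LawlerSchrammWerner2004, §3.2] -/
theorem rn_abs_integral_main_le {Ω : Type*} [MeasurableSpace Ω] {P : Measure Ω}
    [IsProbabilityMeasure P] {x δ K C : ℝ} {W t U D q : Ω → ℝ}
    (hWm : AEStronglyMeasurable W P) (htm : AEStronglyMeasurable t P)
    (hqm : AEStronglyMeasurable q P)
    (hW : ∀ ω, |W ω| ≤ 2 * δ) (ht : ∀ ω, 0 ≤ t ω ∧ t ω ≤ 2 * δ ^ 2)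
    (hF : ∀ ω, |rnF x (U ω) (D ω) (W ω) - 1 -
      (5 / 4 * W ω / x + (45 / 32 * W ω ^ 2 - 15 / 4 * t ω) / x ^ 2)| ≤ C * δ ^ 3)
    (hq : ∀ ω, |q ω - rnF x (U ω) (D ω) (W ω)| ≤ K * δ ^ 3) (hqint : ∫ ω, q ω ∂P = 1) :
    |5 / 4 * (∫ ω, W ω ∂P) / x +
        (45 / 32 * (∫ ω, W ω ^ 2 ∂P) - 15 / 4 * (∫ ω, t ω ∂P)) / x ^ 2| ≤ (C + K) * δ ^ 3 := by
  have hWi : Integrable W P := Integrable.of_bound hWm (2 * δ) (ae_of_all _ fun ω ↦ by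
    rw [Real.norm_eq_abs]; exact hW ω)
  have hW2i : Integrable (fun ω ↦ W ω ^ 2) P := Integrable.of_bound (hWm.pow 2) ((2 * δ) ^ 2)
    (ae_of_all _ fun ω ↦ by
      rw [Real.norm_eq_abs, abs_pow]; exact pow_le_pow_left₀ (abs_nonneg _) (hW ω) 2)
  have hti : Integrable t P := Integrable.of_bound htm (2 * δ ^ 2) (ae_of_all _ fun ω ↦ by
    rw [Real.norm_eq_abs, abs_of_nonneg (ht ω).1]; exact (ht ω).2)
  have hAi : Integrable (fun ω ↦ 5 / 4 * W ω / x) P := (hWi.const_mul (5 / 4)).div_const x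
  have hBi : Integrable (fun ω ↦ (45 / 32 * W ω ^ 2 - 15 / 4 * t ω) / x ^ 2) P :=
    ((hW2i.const_mul (45 / 32)).sub (hti.const_mul (15 / 4))).div_const (x ^ 2)
  have hXi : Integrable
      (fun ω ↦ 5 / 4 * W ω / x + (45 / 32 * W ω ^ 2 - 15 / 4 * t ω) / x ^ 2) P := hAi.add hBi
  -- `q - 1 - (main term)` is bounded, so `q` is integrable
  have hdi : Integrable (fun ω ↦ q ω - 1 -
      (5 / 4 * W ω / x + (45 / 32 * W ω ^ 2 - 15 / 4 * t ω) / x ^ 2)) P := by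
    refine Integrable.of_bound ((hqm.sub aestronglyMeasurable_const).sub hXi.aestronglyMeasurable)
      (K * δ ^ 3 + C * δ ^ 3) (ae_of_all _ fun ω ↦ ?_)
    rw [Real.norm_eq_abs,
      show q ω - 1 - (5 / 4 * W ω / x + (45 / 32 * W ω ^ 2 - 15 / 4 * t ω) / x ^ 2) =
        (q ω - rnF x (U ω) (D ω) (W ω)) + (rnF x (U ω) (D ω) (W ω) - 1 -
          (5 / 4 * W ω / x + (45 / 32 * W ω ^ 2 - 15 / 4 * t ω) / x ^ 2)) by ring]
    exact (abs_add_le _ _).trans (add_le_add (hq ω) (hF ω))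
  have hqi : Integrable q P :=
    ((hdi.add (integrable_const (1 : ℝ))).add hXi).congr (ae_of_all _ fun ω ↦ by
      simp only [Pi.add_apply]; ring)
  have hb : |∫ ω, (5 / 4 * W ω / x + (45 / 32 * W ω ^ 2 - 15 / 4 * t ω) / x ^ 2) ∂P| ≤
      |(1 : ℝ)| * ((C + K) * δ ^ 3) := by
    refine USTPeano.KeyEstimate.abs_integral_le_of_pointwise one_ne_zero hXi hqi hqint
      fun ω ↦ ?_
    rw [div_one,
      show 5 / 4 * W ω / x + (45 / 32 * W ω ^ 2 - 15 / 4 * t ω) / x ^ 2 - (q ω - 1) =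
        -(rnF x (U ω) (D ω) (W ω) - 1 -
          (5 / 4 * W ω / x + (45 / 32 * W ω ^ 2 - 15 / 4 * t ω) / x ^ 2)) -
        (q ω - rnF x (U ω) (D ω) (W ω)) by ring]
    refine (abs_sub _ _).trans ?_
    rw [abs_neg]; linarith [hF ω, hq ω]
  have hXeq : ∫ ω, (5 / 4 * W ω / x + (45 / 32 * W ω ^ 2 - 15 / 4 * t ω) / x ^ 2) ∂P =
      5 / 4 * (∫ ω, W ω ∂P) / x +
        (45 / 32 * (∫ ω, W ω ^ 2 ∂P) - 15 / 4 * (∫ ω, t ω ∂P)) / x ^ 2 := by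
    rw [integral_add hAi hBi, integral_div, integral_const_mul, integral_div,
      integral_sub (hW2i.const_mul (45 / 32)) (hti.const_mul (15 / 4)), integral_const_mul,
      integral_const_mul]
  rw [abs_one, one_mul, hXeq] at hb
  exact hb

/-- **The key estimate for the SAW driving function from the change-of-target observable
(`κ = 8/3`).** On a probability space carrying the driving increment `W` (`|W| ≤ 2δ`), the
capacity increment `t` (`0 ≤ t ≤ 2δ²`), the Loewner data `Uᵢ = g(xᵢ)`, `Dᵢ = g′(xᵢ)` of two
auxiliary boundary targets `x₁ ∈ [1, 2]`, `x₂ ∈ [-2, -1]` obeying the far-field expansions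
`|Uᵢ - xᵢ - 2t/xᵢ| ≤ Kδ³`, `|Dᵢ - (1 - 2t/xᵢ²)| ≤ Kδ³`, and two observables `qᵢ` of mean `1` with
`|qᵢ - rnF xᵢ Uᵢ Dᵢ W| ≤ Kδ³`: then `|E[W]| ≤ Cδ³` and `|E[W²] - (8/3) E[t]| ≤ Cδ³` for
`0 < δ ≤ δ₀` (`δ₀, C` depending only on `K`) — [LSW04]'s "observable ⇒ key estimate" step for
the functional `(x² D/(U - W)²)^{5/8}`. [cite: LawlerSchrammWerner2004, §3.2] -/
theorem rnKey_of_estimates (K : ℝ) (hK : 0 ≤ K) : ∃ δ₀ : ℝ, 0 < δ₀ ∧ ∃ C : ℝ, ∀ δ : ℝ,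
    0 < δ → δ ≤ δ₀ → ∀ {Ω : Type*} [MeasurableSpace Ω] (P : Measure Ω) [IsProbabilityMeasure P]
      (x₁ x₂ : ℝ) (W t U₁ D₁ U₂ D₂ q₁ q₂ : Ω → ℝ),
      1 ≤ x₁ → x₁ ≤ 2 → -2 ≤ x₂ → x₂ ≤ -1 →
      AEStronglyMeasurable W P → AEStronglyMeasurable t P →
      AEStronglyMeasurable q₁ P → AEStronglyMeasurable q₂ P →
      (∀ ω, |W ω| ≤ 2 * δ) → (∀ ω, 0 ≤ t ω ∧ t ω ≤ 2 * δ ^ 2) →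
      (∀ ω, |U₁ ω - x₁ - 2 * t ω / x₁| ≤ K * δ ^ 3) →
      (∀ ω, |D₁ ω - (1 - 2 * t ω / x₁ ^ 2)| ≤ K * δ ^ 3) →
      (∀ ω, |U₂ ω - x₂ - 2 * t ω / x₂| ≤ K * δ ^ 3) →
      (∀ ω, |D₂ ω - (1 - 2 * t ω / x₂ ^ 2)| ≤ K * δ ^ 3) →
      (∀ ω, |q₁ ω - rnF x₁ (U₁ ω) (D₁ ω) (W ω)| ≤ K * δ ^ 3) → ∫ ω, q₁ ω ∂P = 1 →
      (∀ ω, |q₂ ω - rnF x₂ (U₂ ω) (D₂ ω) (W ω)| ≤ K * δ ^ 3) → ∫ ω, q₂ ω ∂P = 1 →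
      |∫ ω, W ω ∂P| ≤ C * δ ^ 3 ∧ |∫ ω, W ω ^ 2 ∂P - 8 / 3 * ∫ ω, t ω ∂P| ≤ C * δ ^ 3 := by
  obtain ⟨δ₀, hδ₀, C, hC⟩ := rnF_taylor K hK
  refine ⟨δ₀, hδ₀, 16 * (C + K), ?_⟩
  intro δ hδ hδδ₀ Ω _ P _ x₁ x₂ W t U₁ D₁ U₂ D₂ q₁ q₂ hx₁ hx₁' hx₂ hx₂' hWm htm hq₁m hq₂m hW ht
    hU₁ hD₁ hU₂ hD₂ hq₁ hq₁i hq₂ hq₂i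
  have hax₁ : |x₁| = x₁ := abs_of_pos (by linarith)
  have hax₂ : |x₂| = -x₂ := abs_of_neg (by linarith)
  have e₁ : ∀ ω, |rnF x₁ (U₁ ω) (D₁ ω) (W ω) - 1 -
      (5 / 4 * W ω / x₁ + (45 / 32 * W ω ^ 2 - 15 / 4 * t ω) / x₁ ^ 2)| ≤ C * δ ^ 3 := fun ω ↦
    hC δ hδ hδδ₀ x₁ (U₁ ω) (D₁ ω) (W ω) (t ω) (by rw [hax₁]; exact hx₁)
      (by rw [hax₁]; exact hx₁') (hW ω) (ht ω).1 (ht ω).2 (hU₁ ω) (hD₁ ω)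
  have e₂ : ∀ ω, |rnF x₂ (U₂ ω) (D₂ ω) (W ω) - 1 -
      (5 / 4 * W ω / x₂ + (45 / 32 * W ω ^ 2 - 15 / 4 * t ω) / x₂ ^ 2)| ≤ C * δ ^ 3 := fun ω ↦
    hC δ hδ hδδ₀ x₂ (U₂ ω) (D₂ ω) (W ω) (t ω) (by rw [hax₂]; linarith)
      (by rw [hax₂]; linarith) (hW ω) (ht ω).1 (ht ω).2 (hU₂ ω) (hD₂ ω)
  have g₁ := rn_abs_integral_main_le hWm htm hq₁m hW ht e₁ hq₁ hq₁i
  have g₂ := rn_abs_integral_main_le hWm htm hq₂m hW ht e₂ hq₂ hq₂i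
  obtain ⟨hB, hM⟩ := rn_key_relations hx₁ hx₁' hx₂ hx₂' g₁ g₂
  have hε : 0 ≤ (C + K) * δ ^ 3 := (abs_nonneg _).trans g₁
  refine ⟨hB.trans (by linarith), ?_⟩
  rw [show ∫ ω, W ω ^ 2 ∂P - 8 / 3 * ∫ ω, t ω ∂P =
      32 / 45 * (45 / 32 * (∫ ω, W ω ^ 2 ∂P) - 15 / 4 * (∫ ω, t ω ∂P)) by ring, abs_mul,
    abs_of_pos (by norm_num : (0 : ℝ) < 32 / 45)]
  linarith

end Literature.Probability.RandomPlanarGeometry.SAWDriving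

end
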